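import Summits.CriticalPhenomena.PercolationContinuityZ3.Theorems.PercNearOneGluingNoHeavyLowerTailAbsorptionGluedPair
import HarnessLib

/-!
# `NoHeavyLowerTail` (stmt-CriticalPhenomena-4575) — the glued-pair margin bound for an ARBITRARY weight of the glued pair

Support file (prover `prim-hp-3`, hull-port line; `--supports stmt-CriticalPhenomena-4575`).  No definitions, no named facts, no sorries.
Lemma (L4) of the refined plan for the overtaking bound (run/shared/lean/prim/prim-hp-3/PROOF-OVERTAKING-BOUND.md §7).

`HullPort.lightness_margin_glue_ge_max` (…AbsorptionGluedPair) assumes the pair `e = s(y,z)` has weight `0` before gluing.  Here the hypothesis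
is removed: **for every weight `w` and `y ≠ z`,**
`I_w(q) − max(I_w(y), I_w(z)) ≤ I_{w[e ↦ 1]}(q) − I_{w[e ↦ 1]}(y)`  (`HullPort.lightness_margin_glue_ge_max_any`).
Proof: one-bond decomposition `I_w = (1 − w e)·I_{w[e↦0]} + (w e)·I_{w[e↦1]}` (`stub_oneBondDecomp_k15`); at weight `0` the landed lemma
(`lightness_margin_le_glue` for the vertex that is lighter AT WEIGHT 0) bounds the margin over that vertex by the glued margin, and the margin at
weight `w e` is the convex combination of the two; in the glued graph `y` and `z` have the same lightness (`lightness_eq_of_weight_one`).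
This is the form the cell inequality of the overtaking bound needs: the representatives of the two blocks may be joined by a pair of positive weight.
-/

noncomputable section

namespace Summit.CriticalPhenomena.PercolationContinuityZ3.Theorems

open MeasureTheory Set Literature.Probability.LatticeModels Literature.Probability.Percolation
open scoped Classical BigOperators

variable {n : ℕ}

namespace HullPort

/-- **Glued-pair margin bound, any weight of the pair.**  For every `w` and `y ≠ z`:
`I_w(q) − max(I_w(y), I_w(z)) ≤ I_{w[s(y,z) ↦ 1]}(q) − I_{w[s(y,z) ↦ 1]}(y)`. [this file] -/
theorem lightness_margin_glue_ge_max_any (w : Sym2 (Fin n) → unitInterval) (A : Finset (Fin n)) (y z q : Fin n) (j : ℕ)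
    (hyz : y ≠ z) :
    (prodBernoulli w).real {ω : BondConfig (Fin n) | (A.filter fun x => ω ∈ openConn q x).card ≤ j} -
        max ((prodBernoulli w).real {ω : BondConfig (Fin n) | (A.filter fun x => ω ∈ openConn y x).card ≤ j})
          ((prodBernoulli w).real {ω : BondConfig (Fin n) | (A.filter fun x => ω ∈ openConn z x).card ≤ j}) ≤
      (prodBernoulli (Function.update w s(y, z) 1)).real
          {ω : BondConfig (Fin n) | (A.filter fun x => ω ∈ openConn q x).card ≤ j} -
        (prodBernoulli (Function.update w s(y, z) 1)).real
          {ω : BondConfig (Fin n) | (A.filter fun x => ω ∈ openConn y x).card ≤ j} := by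
  set e : Sym2 (Fin n) := s(y, z) with he
  set w₀ := Function.update w e 0 with hw₀
  set w₁ := Function.update w e 1 with hw₁
  set Rq := {ω : BondConfig (Fin n) | (A.filter fun x => ω ∈ openConn q x).card ≤ j} with hRq
  set Ry := {ω : BondConfig (Fin n) | (A.filter fun x => ω ∈ openConn y x).card ≤ j} with hRy
  set Rz := {ω : BondConfig (Fin n) | (A.filter fun x => ω ∈ openConn z x).card ≤ j} with hRz
  have hw₀e : w₀ s(y, z) = 0 := by simp [hw₀, he]
  have hw₀1 : Function.update w₀ s(y, z) 1 = w₁ := by rw [hw₀, hw₁, he, Function.update_idem]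
  have ht0 : 0 ≤ (w e : ℝ) := (w e).2.1
  have ht1 : (w e : ℝ) ≤ 1 := (w e).2.2
  -- one-bond decompositions at `e`
  have dq := stub_oneBondDecomp_k15 n w e Rq
  have dy := stub_oneBondDecomp_k15 n w e Ry
  have dz := stub_oneBondDecomp_k15 n w e Rz
  -- in the glued graph `y` and `z` have the same lightness
  have hsame : (prodBernoulli w₁).real Ry = (prodBernoulli w₁).real Rz :=
    lightness_eq_of_weight_one w₁ A hyz j (by simp [hw₁, he])
  by_cases h : (prodBernoulli w₀).real Rz ≤ (prodBernoulli w₀).real Ry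
  · -- `y` is the heavier-to-beat vertex at weight 0: margin over `y` grows under gluing
    have hglue := lightness_margin_le_glue w₀ A y z q j hyz hw₀e h
    rw [hw₀1] at hglue
    have hmax : (prodBernoulli w).real Ry ≤ max ((prodBernoulli w).real Ry) ((prodBernoulli w).real Rz) := le_max_left _ _
    -- margin at weight `w e` is the convex combination of the margins at 0 and 1
    have hconv : (prodBernoulli w).real Rq - (prodBernoulli w).real Ry ≤
        (prodBernoulli w₁).real Rq - (prodBernoulli w₁).real Ry := by
      rw [dq, dy]
      have hb : (1 - (w e : ℝ)) * ((prodBernoulli w₀).real Rq - (prodBernoulli w₀).real Ry) ≤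
          (1 - (w e : ℝ)) * ((prodBernoulli w₁).real Rq - (prodBernoulli w₁).real Ry) :=
        mul_le_mul_of_nonneg_left hglue (by linarith)
      linarith [hb]
    linarith [hconv, hmax]
  · have h' : (prodBernoulli w₀).real Ry ≤ (prodBernoulli w₀).real Rz := le_of_lt (not_le.1 h)
    have hzy : s(z, y) = s(y, z) := Sym2.eq_swap
    have hw₀e' : w₀ s(z, y) = 0 := by rw [hzy]; exact hw₀e
    have hglue := lightness_margin_le_glue w₀ A z y q j hyz.symm hw₀e' h'
    rw [hzy, hw₀1] at hglue
    have hmax : (prodBernoulli w).real Rz ≤ max ((prodBernoulli w).real Ry) ((prodBernoulli w).real Rz) := le_max_right _ _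
    have hconv : (prodBernoulli w).real Rq - (prodBernoulli w).real Rz ≤
        (prodBernoulli w₁).real Rq - (prodBernoulli w₁).real Rz := by
      rw [dq, dz]
      have hb : (1 - (w e : ℝ)) * ((prodBernoulli w₀).real Rq - (prodBernoulli w₀).real Rz) ≤
          (1 - (w e : ℝ)) * ((prodBernoulli w₁).real Rq - (prodBernoulli w₁).real Rz) :=
        mul_le_mul_of_nonneg_left hglue (by linarith)
      linarith [hb]
    rw [hsame]
    linarith [hconv, hmax]

end HullPort

end Summit.CriticalPhenomena.PercolationContinuityZ3.Theorems
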